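import Summits.NavierStokesRegularity.FluidComputer.BlockReachRigidity

/-!
# Fluid computer, block design — LOADING RIGIDITY and exactness on the clean states

HONEST FRAMING: low prior, high value-of-information experiment on Tao's machine paradigm; NOT a
claim that NS blows up. This file proves NOTHING about blow-up and does NOT claim that any residue
of this lane holds. It continues the structural analysis of the re-typed residue
`OpenReachBound 𝒟 P F U ε` (`BlockQuadReach.lean`) begun in `BlockReachRigidity.lean`.

WHAT IS PROVED. (§1, trilinear algebra on `H¹⁰_df`, from the tree's linearity of the Euler form,
its symmetry and Tao's cancellation law `⟨B(u,u),u⟩ = 0`) the binomial expansion of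
`⟨B(ax+by, ax+by), w⟩` and the POLARISED CANCELLATION LAW `⟨B(x,x),y⟩ + 2⟨B(x,y),x⟩ = 0`
(`x, y ∈ H¹⁰_df`; the `t`-coefficient of `⟨B(x+ty,x+ty),x+ty⟩ ≡ 0`). (§2) The CLOSED FORM of the
two-mode Galerkin–Navier–Stokes field of `BlockReachRigidity.lean` at EVERY readout point:
`nsVF n (A,B) = (-Λ_n A - AB√E_{n+1} κ_n + B² (E_{n+1}/√E_n) κ'_n,
                 -Λ_{n+1} B + A² (E_n/√E_{n+1}) κ_n - AB√E_n κ'_n)`,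
with the forward / backscatter coefficients `κ_n = fwdCoef 𝒟 n`, `κ'_n = backCoef 𝒟 n` (the cross
pairings `2⟨B(ψ_n,ψ_{n+1}),ψ_n⟩ = -κ_n` and `2⟨B(ψ_n,ψ_{n+1}),ψ_{n+1}⟩ = -κ'_n` are the polarised
law). (§3, LOADING RIGIDITY) For the damped gate `dampedQuadVF k η γ γ'` on the loaded region
`{a² + ηb² > 2}` (`η ≥ 1/2`), an inhabited residue forces, besides the four identities of
`BlockReachRigidity.lean`, the FIFTH identity `kη = unit n · √E_{n+1} κ_n` (test on the line
`{(A,1) : A ≥ 2}`), hence, when the gate is not switched off (`k ≠ 0`), `η = E_{n+1}/E_n = S.eta`: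
THE LOADING PARAMETER OF THE GATE IS THE SPEC'S ENERGY RATIO — the value the lane's design uses
(`loadedRegion S.eta`, `quadVF k S.eta` in `BlockQuadReach.lean`) is the ONLY consistent one.
(§4, EXACTNESS ON THE CLEAN STATES) Conversely the five identities make the law EXACT at every
clean design state: `unit n • nsVF n p = dampedQuadVF k η γ γ' p` for ALL `p ∈ ℝ²` (not only on
`U`, and with defect `0`, not `ε`); in particular an inhabited residue implies this exact identity.
[folklore]

HONEST READING. (1) At the clean two-mode states the residue's `defect` clause is now DECIDED: it
holds there (exactly) iff the five identities hold; they are conditions on (clock, spec, wavelet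
data) that this file neither verifies nor expects of a generic admissible `𝒟` (`κ'_n(𝒟) = 0` for
all `n` is a codimension-one condition per block before the dyadic self-similarity of the modes is
used). (2) What remains GENUINELY IDEA-BOUND in `defect` is its content at states with non-zero
junk below the ceiling (junk feedback on the readout) — untouched here — and the whole `junk_rate`
clause. (3) Nothing here touches the design-level theorems of `BlockQuad*`, bp1's reach layer, or
the whole-tick residue `OpenIdeaBound`; the no-go of `BlockReachViscous.lean` is not imported.
-/

noncomputable section

open MeasureTheory Set Filter Topology Metric
open scoped ENNReal NNReal

namespace Summit.NavierStokesRegularity.FluidComputer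

open Literature.Analysis.FluidPDE Literature.Analysis.FluidPDE.Tao2016
open Literature.Analysis.FluidPDE.FluidComputer
open Literature.Analysis.FunctionSpaces (eFourierSobolevNorm)
open Summit.NavierStokesRegularity.NavierStokesRegularity.Theorems.FluidComputer
open Summit.NavierStokesRegularity.NavierStokesRegularity.Theorems.PerpetualPumpEulerTypeIGlue
  (eulerForm_smul_smul)

namespace BlockDesign

/-! ### §1. Trilinear algebra of the Euler form on `H¹⁰_df` -/
section Trilinear

/-- Binomial expansion, one scalar: `⟨B(x+by,x+by),w⟩ = ⟨B(x,x),w⟩ + 2b⟨B(x,y),w⟩ + b²⟨B(y,y),w⟩`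
(`x, y ∈ H¹⁰_df`, `b ∈ ℝ`). [cite: Tao2016AveragedNS, §1.1 (1.3)] -/
theorem eulerForm_add_smul_self {x y : L2C} (hx : MemH10df x) (hy : MemH10df y) (b : ℝ)
    (w : L2C) :
    eulerForm (x + (b : ℂ) • y) (x + (b : ℂ) • y) w =
      eulerForm x x w + 2 * (b : ℂ) * eulerForm x y w + (b : ℂ) ^ 2 * eulerForm y y w := by
  have hxy : eFourierSobolevNorm 10 (x + (b : ℂ) • y) < ∞ := (hx.add (hy.smul b)).1
  rw [eulerForm_add_smul₁ (b : ℂ) w hx.1 hy.1 hxy, eulerForm_add_smul₂ (b : ℂ) w hx.1 hx.1 hy.1,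
    eulerForm_add_smul₂ (b : ℂ) w hy.1 hx.1 hy.1, eulerForm_symm y x w]
  ring

/-- Binomial expansion, two scalars: `⟨B(ax+by,ax+by),w⟩ = a²⟨B(x,x),w⟩ + 2ab⟨B(x,y),w⟩ +
b²⟨B(y,y),w⟩` (`x, y ∈ H¹⁰_df`, `a, b ∈ ℝ`). [cite: Tao2016AveragedNS, §1.1 (1.3)] -/
theorem eulerForm_lincomb_self (a b : ℝ) {x y : L2C} (hx : MemH10df x) (hy : MemH10df y)
    (w : L2C) :
    eulerForm ((a : ℂ) • x + (b : ℂ) • y) ((a : ℂ) • x + (b : ℂ) • y) w =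
      (a : ℂ) ^ 2 * eulerForm x x w + 2 * (a : ℂ) * (b : ℂ) * eulerForm x y w +
        (b : ℂ) ^ 2 * eulerForm y y w := by
  rw [eulerForm_add_smul_self (hx.smul a) hy b w, eulerForm_smul_smul, eulerForm_smul₁]
  ring

/-- **POLARISED CANCELLATION LAW**: `⟨B(x,x),y⟩ + 2⟨B(x,y),x⟩ = 0` for `x, y ∈ H¹⁰_df` — the
`t`-coefficient of Tao's cancellation `⟨B(x+ty,x+ty),x+ty⟩ = 0` (compare `t = ±1`).
[cite: Tao2016AveragedNS, §1.1 (1.2) p. 3] -/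
theorem eulerForm_polar {x y : L2C} (hx : MemH10df x) (hy : MemH10df y) :
    eulerForm x x y + 2 * eulerForm x y x = 0 := by
  have cubic : ∀ c : ℝ, eulerForm (x + (c : ℂ) • y) (x + (c : ℂ) • y) (x + (c : ℂ) • y) =
      eulerForm x x x + (c : ℂ) * (eulerForm x x y + 2 * eulerForm x y x) +
        (c : ℂ) ^ 2 * (2 * eulerForm x y y + eulerForm y y x) +
          (c : ℂ) ^ 3 * eulerForm y y y := by
    intro c
    have hP : MemH10df (x + (c : ℂ) • y) := hx.add (hy.smul c)
    rw [eulerForm_add_smul₃ (c : ℂ) x y hP.1 hP.1, eulerForm_add_smul_self hx hy c x,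
      eulerForm_add_smul_self hx hy c y]
    ring
  have h1 := cubic 1
  have h2 := cubic (-1)
  rw [eulerForm_self_eq_zero_of_memH10df (hx.add (hy.smul 1))] at h1
  rw [eulerForm_self_eq_zero_of_memH10df (hx.add (hy.smul (-1)))] at h2
  rw [eulerForm_self_eq_zero_of_memH10df hx, eulerForm_self_eq_zero_of_memH10df hy] at h1 h2
  push_cast at h1 h2
  linear_combination (h2 - h1) / 2

end Trilinear

/-! ### §2. Closed form of the two-mode Galerkin–Navier–Stokes field -/
section Calculus

variable (𝒟 : CascadeWaveletData 1 1) (S : CascadeSpecs)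

/-- The design modes are in `H¹⁰_df`. [cite: Tao2016AveragedNS, §4] -/
theorem memH10df_mode (n : ℕ) : MemH10df (mode 𝒟 n) :=
  𝒟.memH10df_cascadeWavelet two_pos' 0 (n : ℤ)

/-- `⟨B(a,a), ψ_n⟩` at the design state `a = recon n (A,B) = A√E_n ψ_n + B√E_{n+1} ψ_{n+1}`:
`-(A√E_n)(B√E_{n+1}) ⟨B(ψ_n,ψ_n),ψ_{n+1}⟩ + (B√E_{n+1})² ⟨B(ψ_{n+1},ψ_{n+1}),ψ_n⟩`. [folklore] -/
theorem eulerForm_recon_mode_fst (n : ℕ) (p : ℝ × ℝ) :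
    eulerForm (recon 𝒟 S n p) (recon 𝒟 S n p) (mode 𝒟 n) =
      ((-(p.1 * Real.sqrt (S.Emin n) * (p.2 * Real.sqrt (S.Emin (n + 1)))) : ℝ) : ℂ) *
          eulerForm (mode 𝒟 n) (mode 𝒟 n) (mode 𝒟 (n + 1)) +
        (((p.2 * Real.sqrt (S.Emin (n + 1))) ^ 2 : ℝ) : ℂ) *
          eulerForm (mode 𝒟 (n + 1)) (mode 𝒟 (n + 1)) (mode 𝒟 n) := by
  have hn := memH10df_mode 𝒟 n
  have hm := memH10df_mode 𝒟 (n + 1)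
  have hpol := eulerForm_polar hn hm
  rw [recon, eulerForm_lincomb_self _ _ hn hm, eulerForm_self_eq_zero_of_memH10df hn]
  push_cast
  linear_combination ((p.1 : ℂ) * (Real.sqrt (S.Emin n) : ℂ)) *
    ((p.2 : ℂ) * (Real.sqrt (S.Emin (n + 1)) : ℂ)) * hpol

/-- `⟨B(a,a), ψ_{n+1}⟩` at `a = recon n (A,B)`:
`(A√E_n)² ⟨B(ψ_n,ψ_n),ψ_{n+1}⟩ - (A√E_n)(B√E_{n+1}) ⟨B(ψ_{n+1},ψ_{n+1}),ψ_n⟩`. [folklore] -/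
theorem eulerForm_recon_mode_snd (n : ℕ) (p : ℝ × ℝ) :
    eulerForm (recon 𝒟 S n p) (recon 𝒟 S n p) (mode 𝒟 (n + 1)) =
      (((p.1 * Real.sqrt (S.Emin n)) ^ 2 : ℝ) : ℂ) *
          eulerForm (mode 𝒟 n) (mode 𝒟 n) (mode 𝒟 (n + 1)) +
        ((-(p.1 * Real.sqrt (S.Emin n) * (p.2 * Real.sqrt (S.Emin (n + 1)))) : ℝ) : ℂ) *
          eulerForm (mode 𝒟 (n + 1)) (mode 𝒟 (n + 1)) (mode 𝒟 n) := by
  have hn := memH10df_mode 𝒟 n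
  have hm := memH10df_mode 𝒟 (n + 1)
  have hpol := eulerForm_polar hm hn
  rw [recon, eulerForm_lincomb_self _ _ hn hm, eulerForm_self_eq_zero_of_memH10df hm,
    eulerForm_symm (mode 𝒟 n) (mode 𝒟 (n + 1)) (mode 𝒟 (n + 1))]
  push_cast
  linear_combination ((p.1 : ℂ) * (Real.sqrt (S.Emin n) : ℂ)) *
    ((p.2 : ℂ) * (Real.sqrt (S.Emin (n + 1)) : ℂ)) * hpol

/-- **CLOSED FORM of the two-mode Galerkin–Navier–Stokes field** at every readout point:
`nsVF n (A,B) = (-Λ_n A - AB√E_{n+1} κ_n + B²(E_{n+1}/√E_n) κ'_n,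
 -Λ_{n+1} B + A²(E_n/√E_{n+1}) κ_n - AB√E_n κ'_n)`. [folklore] -/
theorem nsVF_eq (n : ℕ) (p : ℝ × ℝ) :
    nsVF 𝒟 S n p =
      (-(viscRate 𝒟 n * p.1) - p.1 * p.2 * Real.sqrt (S.Emin (n + 1)) * fwdCoef 𝒟 n +
          p.2 ^ 2 * (S.Emin (n + 1) / Real.sqrt (S.Emin n)) * backCoef 𝒟 n,
        -(viscRate 𝒟 (n + 1) * p.2) + p.1 ^ 2 * (S.Emin n / Real.sqrt (S.Emin (n + 1))) *
            fwdCoef 𝒟 n - p.1 * p.2 * Real.sqrt (S.Emin n) * backCoef 𝒟 n) := by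
  have h1 := eulerForm_recon_mode_fst 𝒟 S n p
  have h2 := eulerForm_recon_mode_snd 𝒟 S n p
  simp only [nsVF, h1, h2, Complex.add_re, Complex.re_ofReal_mul, Prod.mk.injEq]
  rw [← fwdCoef, ← backCoef]
  obtain ⟨s, hs, hsE⟩ : ∃ s : ℝ, 0 < s ∧ Real.sqrt (S.Emin n) = s := ⟨_, sqrt_Emin_pos S n, rfl⟩
  obtain ⟨t, ht, htE⟩ : ∃ t : ℝ, 0 < t ∧ Real.sqrt (S.Emin (n + 1)) = t :=
    ⟨_, sqrt_Emin_pos S (n + 1), rfl⟩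
  have hEn : S.Emin n = s ^ 2 := by rw [← hsE, Real.sq_sqrt (S.Emin_pos n).le]
  have hEm : S.Emin (n + 1) = t ^ 2 := by rw [← htE, Real.sq_sqrt (S.Emin_pos (n + 1)).le]
  rw [hsE, htE, hEn, hEm]
  constructor
  · field_simp
    ring
  · field_simp
    ring

/-- Input component on the line `B = 1`. [folklore] -/
theorem nsVF_fst_line (n : ℕ) (A : ℝ) :
    (nsVF 𝒟 S n (A, 1)).1 = -(viscRate 𝒟 n * A) - A * Real.sqrt (S.Emin (n + 1)) * fwdCoef 𝒟 n +
      S.Emin (n + 1) / Real.sqrt (S.Emin n) * backCoef 𝒟 n := by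
  simp only [nsVF_eq]
  ring

end Calculus

/-! ### §3. Loading rigidity: `kη = unit n √E_{n+1} κ_n`, hence `η = S.eta` -/
variable {𝒟 : CascadeWaveletData 1 1} {S : CascadeSpecs} {P : Params S} {ε : ℝ}

/-- The lines `{(A,B) : A ≥ 2}` lie in the loaded region `{a² + ηb² > 2}` (`η ≥ 0`). [folklore] -/
theorem mem_loadedRegion_of_two_le {η : ℝ} (hη : 0 ≤ η) {A : ℝ} (hA : 2 ≤ A) (B : ℝ) :
    ((A, B) : ℝ × ℝ) ∈ loadedRegion η := by
  show 2 < pairEnergy η _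
  unfold pairEnergy
  nlinarith [mul_nonneg hη (sq_nonneg B)]

/-- The damped gate's input component. [folklore] -/
theorem dampedQuadVF_fst (k η γ γ' : ℝ) (z : ℝ × ℝ) :
    (dampedQuadVF k η γ γ' z).1 = -(k * η * z.1 * z.2) - γ * z.1 := rfl

/-- **LOADING RIGIDITY.** For the damped gate on the loaded region (`η ≥ 1/2`), an inhabited
residue forces the FIFTH identity `kη = unit n · √E_{n+1} · κ_n` for every block `n` (test the
law at `t = 0` on the clean states `recon n (A, 1)`, `A ≥ 2`: the `AB`-cross term of the input
component is `-unit n · A · √E_{n+1} κ_n` against the gate's `-kη A`). [folklore] -/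
theorem OpenReachBound.loading_eq {k η γ γ' : ℝ} (hη : 1 / 2 ≤ η)
    (H : OpenReachBound 𝒟 P (dampedQuadVF k η γ γ') (loadedRegion η) ε) (n : ℕ) :
    k * η = H.unit n * Real.sqrt (S.Emin (n + 1)) * fwdCoef 𝒟 n := by
  obtain ⟨hγ, -, -, hback⟩ := H.dampedQuad_constants_loaded hη n
  refine eq_of_sub_eq_zero (eq_zero_of_abs_mul_le_of_ray (A₀ := 2) (c := ε) fun A hA => ?_)
  have h := H.abs_fst_le n (mem_loadedRegion_of_two_le (by linarith) hA 1)
  rw [nsVF_fst_line, hback, dampedQuadVF_fst] at h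
  calc |(k * η - H.unit n * Real.sqrt (S.Emin (n + 1)) * fwdCoef 𝒟 n) * A|
      = |H.unit n * (-(viscRate 𝒟 n * A) - A * Real.sqrt (S.Emin (n + 1)) * fwdCoef 𝒟 n +
            S.Emin (n + 1) / Real.sqrt (S.Emin n) * 0) - (-(k * η * A * 1) - γ * A)| := by
        congr 1
        linear_combination (-A) * hγ
    _ ≤ ε := h

/-- **THE LOADING PARAMETER IS THE ENERGY RATIO.** If moreover the gate is not switched off
(`k ≠ 0`), then `η = E_{n+1}/E_n`, i.e. `η = S.eta` (the spec's geometric energy ratio,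
`E_{n+1} = S.eta · E_n`). [folklore] -/
theorem OpenReachBound.eta_eq {k η γ γ' : ℝ} (hη : 1 / 2 ≤ η)
    (H : OpenReachBound 𝒟 P (dampedQuadVF k η γ γ') (loadedRegion η) ε) (hk : k ≠ 0) :
    η = S.eta := by
  obtain ⟨-, -, hk', -⟩ := H.dampedQuad_constants_loaded hη 0
  have hload := H.loading_eq hη 0
  have hE0 := S.Emin_pos 0
  have hs1 := sqrt_Emin_pos S (0 + 1)
  have hE1 : Real.sqrt (S.Emin (0 + 1)) ^ 2 = S.eta * S.Emin 0 := by
    rw [Real.sq_sqrt (S.Emin_pos (0 + 1)).le, S.Emin_succ 0]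
  -- `k √E_1 = unit E_0 κ_0`
  have hkt : k * Real.sqrt (S.Emin (0 + 1)) = H.unit 0 * S.Emin 0 * fwdCoef 𝒟 0 := by
    have := hk'
    field_simp at this
    linear_combination this
  -- `k η E_0 = E_0 unit √E_1 κ_0 = √E_1 (k √E_1) = k S.eta E_0`
  have h2 : k * (η - S.eta) * S.Emin 0 = 0 := by
    linear_combination (S.Emin 0) * hload - Real.sqrt (S.Emin (0 + 1)) * hkt + k * hE1
  rcases mul_eq_zero.1 h2 with h3 | h3
  · rcases mul_eq_zero.1 h3 with h4 | h4
    · exact absurd h4 hk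
    · linarith
  · exact absurd h3 hE0.ne'

/-! ### §4. Exactness of the law on the clean states -/
section Exact

variable (𝒟) (S)

/-- **THE FIVE IDENTITIES MAKE THE LAW EXACT ON THE CLEAN STATES**: if `γ = υΛ_n`, `γ' = υΛ_{n+1}`,
`k = υ E_n κ_n/√E_{n+1}`, `kη = υ √E_{n+1} κ_n` and `κ'_n = 0`, then
`υ • nsVF n p = dampedQuadVF k η γ γ' p` for EVERY `p ∈ ℝ²`. [folklore] -/
theorem nsVF_eq_dampedQuadVF_of_identities {k η γ γ' υ : ℝ} (n : ℕ)
    (hγ : γ = υ * viscRate 𝒟 n) (hγ' : γ' = υ * viscRate 𝒟 (n + 1))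
    (hk : k = υ * S.Emin n * fwdCoef 𝒟 n / Real.sqrt (S.Emin (n + 1)))
    (hload : k * η = υ * Real.sqrt (S.Emin (n + 1)) * fwdCoef 𝒟 n) (hback : backCoef 𝒟 n = 0)
    (p : ℝ × ℝ) : υ • nsVF 𝒟 S n p = dampedQuadVF k η γ γ' p := by
  have hsm := sqrt_Emin_pos S (n + 1)
  rw [nsVF_eq, hback]
  simp only [dampedQuadVF, Prod.smul_mk, smul_eq_mul, Prod.mk.injEq]
  constructor
  · have : k * η * p.1 * p.2 = υ * Real.sqrt (S.Emin (n + 1)) * fwdCoef 𝒟 n * p.1 * p.2 := by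
      rw [hload]
    rw [hγ]
    linear_combination this
  · rw [hγ', hk]
    field_simp
    ring

end Exact

/-- **An inhabited residue makes the law exact on the clean states**: for the damped gate on the
loaded region (`η ≥ 1/2`), `unit n • nsVF n p = dampedQuadVF k η γ γ' p` for EVERY `p ∈ ℝ²` and
every block `n` — an `ε`-accurate law on `U` is automatically an EXACT law on all of `ℝ²` at the
clean states. Not a claim that such a residue holds. [folklore] -/
theorem OpenReachBound.clean_exact {k η γ γ' : ℝ} (hη : 1 / 2 ≤ η)
    (H : OpenReachBound 𝒟 P (dampedQuadVF k η γ γ') (loadedRegion η) ε) (n : ℕ) (p : ℝ × ℝ) :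
    H.unit n • nsVF 𝒟 S n p = dampedQuadVF k η γ γ' p := by
  obtain ⟨hγ, hγ', hk, hback⟩ := H.dampedQuad_constants_loaded hη n
  exact nsVF_eq_dampedQuadVF_of_identities 𝒟 S n hγ hγ' hk (H.loading_eq hη n) hback p

/-- Consequently the defect of an inhabited residue VANISHES at the clean states of `U`: the
`ε` of the law is spent entirely on states with non-zero junk. [folklore] -/
theorem OpenReachBound.norm_defect_clean_eq_zero {k η γ γ' : ℝ} (hη : 1 / 2 ≤ η)
    (H : OpenReachBound 𝒟 P (dampedQuadVF k η γ γ') (loadedRegion η) ε) (n : ℕ) (p : ℝ × ℝ) :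
    ‖H.unit n • nsVF 𝒟 S n p - dampedQuadVF k η γ γ' p‖ = 0 := by
  rw [H.clean_exact hη n p, sub_self, norm_zero]

end BlockDesign

end Summit.NavierStokesRegularity.FluidComputer
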